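import Literature.MathematicalPhysics.QuantumLattice.SectorEigenvalueContinuation
import HarnessLib

/-!
# Route `JosephsonMirror` — the gap above a degenerate floor (crux `JmPairBridge`, line `schur-rigid-bridge`)

Support lemma for the crux item stmt-HubbardSuperconductivity-2226 (`JmPairBridge`) of route
`JosephsonMirror` (sub-problem `HubbardSuperconductivity`), stub `stub_floorGap` of the checked
line `schur-rigid-bridge`.

Let `A` be a Hermitian matrix on `ι → ℂ` preserving a subspace `K`, and let `m` be a lower bound
of its quadratic form on `K` (`m ‖v‖² ≤ Re ⟨v, A v⟩` for `v ∈ K`). The *floor* of `A` in `K` is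
`Fl = {ψ ∈ K | A ψ = m ψ}`; let `W = K ∩ Flᗮ` be the vectors of `K` orthogonal to every floor
vector. Then there is `μ > m` with `μ ‖w‖² ≤ Re ⟨w, A w⟩` on `W`, and either `W = {0}` or `μ` is
attained on `W` by an eigenvector of `A` (the second eigenvalue of `A` on `K`).

Proof: `W` is an `A`-invariant subspace (Hermiticity moves `A` onto the floor vector, where it
acts as the real scalar `m`). If the unit sphere of `W` is empty, `W = {0}` and `μ = m + 1` works
vacuously. Otherwise minimise the (continuous) energy on the (compact) unit sphere of `W`; the
minimum `μ` bounds the form on `W` from below by homogeneity, the minimiser `w₀` is an eigenvector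
with eigenvalue `μ` by the variational principle on the invariant subspace `W`
(`mulVec_eq_smul_of_forall_le_on`), `m ≤ μ` by the hypothesis, and `μ ≠ m` since otherwise `w₀`
would be a floor vector orthogonal to itself. This is `exists_gap_of_unique` of
`Literature.MathematicalPhysics.QuantumLattice.SectorEigenvalueContinuation` with the line `ℂ ψ₀`
replaced by the whole (possibly degenerate) floor.

Sources: H. Tasaki, *Physics and Mathematics of Quantum Many-Body Systems* (2020), §2.1 (the
variational characterisation of low-lying eigenvalues); T. Kato, *Perturbation Theory for Linear
Operators* (1966), Ch. I §6.10 (isolation distance of an eigenvalue of a symmetric operator).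
No new definitions.
-/

noncomputable section

-- the mandated namespace `Summit.<Summit>.<Problem>.Theorems` repeats `HubbardSuperconductivity`
-- (single-problem summit), which the `dupNamespace` linter flags on every declaration
set_option linter.dupNamespace false

namespace Summit.HubbardSuperconductivity.HubbardSuperconductivity.Theorems.JosephsonMirror

open Matrix Literature.MathematicalPhysics.QuantumLattice
  Literature.MathematicalPhysics.QuantumLattice.EigenvalueContinuation

/-- **The gap above a degenerate floor.** Let `A` be Hermitian, preserving the subspace `K`, with
`m ‖v‖² ≤ Re ⟨v, A v⟩` on `K`. Then there is `μ > m` such that `μ ‖w‖² ≤ Re ⟨w, A w⟩` for every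
`w ∈ K` orthogonal to the floor `{ψ ∈ K | A ψ = m ψ}`, and either every such `w` vanishes or `μ`
is attained there by an eigenvector `φ` of `A` (`A φ = μ φ`, `φ ≠ 0`): the second eigenvalue of
`A` on `K`. Compactness of the unit sphere of the invariant subspace `K ∩ floorᗮ` and the
variational principle `mulVec_eq_smul_of_forall_le_on`; cf. `exists_gap_of_unique`.
Tasaki (2020) §2.1; Kato (1966) I §6.10. [folklore] -/
theorem stub_floorGap {ι : Type*} [Fintype ι] (A : Matrix ι ι ℂ) (hA : Aᴴ = A)
    (K : Submodule ℂ (ι → ℂ)) (hK : ∀ v ∈ K, A *ᵥ v ∈ K) (m : ℝ)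
    (hm : ∀ v ∈ K, m * (star v ⬝ᵥ v).re ≤ (star v ⬝ᵥ A *ᵥ v).re) :
    ∃ μ : ℝ, m < μ ∧
      (∀ w ∈ K, (∀ ψ ∈ K, A *ᵥ ψ = (m : ℂ) • ψ → star ψ ⬝ᵥ w = 0) →
        μ * (star w ⬝ᵥ w).re ≤ (star w ⬝ᵥ A *ᵥ w).re) ∧
      ((∀ w ∈ K, (∀ ψ ∈ K, A *ᵥ ψ = (m : ℂ) • ψ → star ψ ⬝ᵥ w = 0) → w = 0) ∨
        (∃ φ ∈ K, φ ≠ 0 ∧ (∀ ψ ∈ K, A *ᵥ ψ = (m : ℂ) • ψ → star ψ ⬝ᵥ φ = 0) ∧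
          A *ᵥ φ = (μ : ℂ) • φ)) := by
  classical
  -- the invariant subspace `W = K ∩ floorᗮ`
  let W : Submodule ℂ (ι → ℂ) :=
    { carrier := {w | w ∈ K ∧ ∀ ψ ∈ K, A *ᵥ ψ = (m : ℂ) • ψ → star ψ ⬝ᵥ w = 0}
      add_mem' := fun {a b} ha hb =>
        ⟨K.add_mem ha.1 hb.1, fun ψ hψK hψ => by
          rw [dotProduct_add, ha.2 ψ hψK hψ, hb.2 ψ hψK hψ, add_zero]⟩
      zero_mem' := ⟨K.zero_mem, fun ψ _ _ => dotProduct_zero _⟩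
      smul_mem' := fun c {a} ha =>
        ⟨K.smul_mem c ha.1, fun ψ hψK hψ => by rw [dotProduct_smul, ha.2 ψ hψK hψ, smul_zero]⟩ }
  have hWinv : ∀ w ∈ W, A *ᵥ w ∈ W := by
    intro w hw
    refine ⟨hK w hw.1, fun ψ hψK hψ => ?_⟩
    rw [star_dotProduct_mulVec_comm hA, hψ, dotProduct_smul, smul_eq_mul, star_mul',
      ← star_dotProduct, hw.2 ψ hψK hψ, mul_zero]
  -- normalisation into the unit sphere `C` of `W`
  set C : Set (ι → ℂ) := {w | w ∈ W ∧ star w ⬝ᵥ w = 1} with hC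
  have hnormal : ∀ w ∈ W, w ≠ 0 →
      ∃ c : ℝ, 0 < c ∧ c * c * (star w ⬝ᵥ w).re = 1 ∧ (c : ℂ) • w ∈ C := by
    intro w hw hw0
    obtain ⟨c, hc, hcc, h1⟩ := exists_normalize hw0
    exact ⟨c, hc, hcc, W.smul_mem _ hw, h1⟩
  by_cases hCne : C.Nonempty
  · -- minimise the energy on the unit sphere of `W`
    obtain ⟨w₀, hw₀C, hmin⟩ :=
      (isCompact_unitSphere_inter W).exists_isMinOn hCne (continuous_energy A).continuousOn
    set μ : ℝ := (star w₀ ⬝ᵥ A *ᵥ w₀).re with hμ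
    have hμle : ∀ w ∈ W, μ * (star w ⬝ᵥ w).re ≤ (star w ⬝ᵥ A *ᵥ w).re := by
      intro w hw
      by_cases hw0 : w = 0
      · simp [hw0]
      obtain ⟨c, hc, hcc, hcC⟩ := hnormal w hw hw0
      have h1 : μ ≤ (star ((c : ℂ) • w) ⬝ᵥ A *ᵥ ((c : ℂ) • w)).re := hmin hcC
      rw [mulVec_smul, star_real_smul_dotProduct_real_smul, Complex.re_ofReal_mul] at h1
      have hpos := re_star_dotProduct_self_pos hw0
      calc μ * (star w ⬝ᵥ w).re ≤ c * c * (star w ⬝ᵥ A *ᵥ w).re * (star w ⬝ᵥ w).re :=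
            mul_le_mul_of_nonneg_right h1 hpos.le
        _ = (star w ⬝ᵥ A *ᵥ w).re * (c * c * (star w ⬝ᵥ w).re) := by ring
        _ = (star w ⬝ᵥ A *ᵥ w).re := by rw [hcc, mul_one]
    -- the minimiser is an eigenvector, with eigenvalue `μ > m`
    have hw₀W : w₀ ∈ W := hw₀C.1
    have heig : A *ᵥ w₀ = (μ : ℂ) • w₀ :=
      mulVec_eq_smul_of_forall_le_on hA W hWinv hμle hw₀W
        (by rw [hw₀C.2, Complex.one_re, mul_one])
    have hw₀0 : w₀ ≠ 0 := by
      intro h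
      have := hw₀C.2
      rw [h, dotProduct_zero] at this
      exact zero_ne_one this
    have hmμ : m ≤ μ := by
      have := hm w₀ hw₀W.1
      rwa [hw₀C.2, Complex.one_re, mul_one, ← hμ] at this
    have hne : m ≠ μ := by
      intro hmμ'
      -- if `μ = m` the minimiser is a floor vector orthogonal to itself
      have heig' : A *ᵥ w₀ = (m : ℂ) • w₀ := by rw [hmμ']; exact heig
      have h0 : star w₀ ⬝ᵥ w₀ = 0 := hw₀W.2 w₀ hw₀W.1 heig'
      rw [hw₀C.2] at h0
      exact one_ne_zero h0
    exact ⟨μ, lt_of_le_of_ne hmμ hne, fun w hwK hw => hμle w ⟨hwK, hw⟩,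
      Or.inr ⟨w₀, hw₀W.1, hw₀0, hw₀W.2, heig⟩⟩
  · -- the unit sphere of `W` is empty: `W = {0}`
    have hW0 : ∀ w ∈ W, w = 0 := by
      intro w hw
      by_contra hw0
      obtain ⟨c, -, -, hcC⟩ := hnormal w hw hw0
      exact hCne ⟨_, hcC⟩
    refine ⟨m + 1, by linarith, fun w hwK hw => ?_, Or.inl fun w hwK hw => hW0 w ⟨hwK, hw⟩⟩
    rw [hW0 w ⟨hwK, hw⟩]
    simp

end Summit.HubbardSuperconductivity.HubbardSuperconductivity.Theorems.JosephsonMirror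

end
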